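import Mathlib
import Summits.Schanuel.Schanuel.Theorems.RigidCoreMinimalCounterexampleInAclCorankGeTwoLogCoords

/-!
# THE MOD-PERIOD SELECTOR — the unconditional content of arithmetic isolation on the log part
# (crux stmt-Schanuel-0969 `RigidCore.MinimalCounterexampleInAcl`, line kernel-arithmetic-selection, lead c14)

`--supports stmt-Schanuel-0969`.  The definable-class selector (`definableClassSelector`, Theorems/…DefinableClassSelector, c12)
isolates a point `u` of an `∅`-definable `V ⊆ ℂ^m` with finite exponential image by its EXACT HIT PATTERN
`H = {κ ∈ ℤ^m : u + 2πiκ ∈ V}` as soon as (the copy of) `H` is `∅`-definable in `ℂ_exp` and `H` has NO PERIOD.  For the log part of a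
corank ≥ 2 first failure the pattern IS definable (it is arithmetical: S7a `stub_corankGeTwo_hitSetRingDefinable`, p144042, plus the
transfer `stub_arithmeticTransfer`), but aperiodicity (⟸ "no full line of mates in a log direction", stub S7b) is open at corank ≥ 2
(obstruction note `Cruxes/MinimalCounterexampleInAcl/Lines/kernel_arithmetic_selection_S7b_obstruction.md`).  This file records what the
lever proves WITHOUT any aperiodicity input:

* `classSelector_modPeriod` — with `V, u, H` as above (pattern copy definable, NO aperiodicity), every integer functional `ℓ` that
  annihilates all periods of `H` has `ℓ·u ∈ acl^{ℂ_exp}(∅)`: the exact-pattern set `T ∋ u` is `∅`-definable, and two of its points with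
  the same exponentials and the same kernel sign differ by `t·μ` with `μ` a PERIOD of `H` (`pattern_translate_period`), so `ℓ·(−)` is
  constant on each exponential class of `T`; hence `ℓ·T` is a finite `∅`-definable subset of `ℂ` containing `ℓ·u`;
* `logCombos_mem_expAcl_of_pattern_modPeriod` — the same in the cast-free coordinate language of Theorems/…CorankGeTwoLogPart: for
  ℚ-linearly independent `x` with `e^{x_i} ∈ ℚ̄` (`i < r`) and `∅`-definable pattern of the log part, every `ℓ ∈ ℤⁿ` supported on the log
  indices and annihilating every period supported on the log indices has `Σ ℓ_i x_i ∈ acl(∅)`;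
* `stub_corankGeTwo_logCombosModPeriod` (registered) — **UNCONDITIONALLY, for every normal-form first failure of rank `n ≥ 3` with
  `r ≤ n − 2` log coordinates, every integer combination of the log coordinates that annihilates the period lattice of the (arithmetical)
  hit pattern lies in `acl^{ℂ_exp}(∅)`.**  The period lattice `P ≤ ℤ^r` is exactly the set of directions `μ` such that EVERY hit line in
  direction `μ` is full; `P = 0` recovers `stub_corankGeTwo_logCoordsAperiodic` (all log coordinates in `acl(∅)`).  So the log part of a
  corank ≥ 2 first failure is `∅`-algebraic modulo `2πi·(P ⊗ ℚ)`, and S7b is needed only to kill `P`.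

Why no finer EQUIVARIANT datum removes `P` (status note §Addendum c14): a datum refining the pattern by rational BOXES around the pure
parts of the mates would be aperiodic for free (closure + kernel-class finiteness `locusMates_cexp_fibre_finite`), but boxes are not
`∅`-definable in `ℂ_exp` (no order/metric); every EXACT integer-indexed datum of the relative pure fibres (kernel differences, Kummer
classes at a fixed level) is generically diagonal and refines nothing.

References: [KirbyMacintyreOnshuus2012] J. Kirby, A. Macintyre, A. Onshuus, *The algebraic numbers definable in various exponential
fields*, J. Inst. Math. Jussieu 11 (2012), arXiv:1101.4224, §2 (`ℤ`, `±2πi` are `∅`-definable in `ℂ_exp`); [Marker2002] D. Marker,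
*Model Theory: An Introduction*, GTM 217, §1.3 (`acl`); [Kirby2010] J. Kirby, *Exponential algebraicity in exponential fields*,
Bull. LMS 42 (2010), arXiv:0810.4285, Prop. 7.2.
-/

noncomputable section

set_option linter.dupNamespace false

open Complex Set FirstOrder

namespace Summit.Schanuel.Schanuel.Cruxes.MinimalCounterexampleInAcl.KernelArithmeticSelection

open Literature.ModelTheory.ExponentialFields
open Summit.Schanuel.Schanuel.Theorems.AclSubsetLogFreeCore.Negative

variable {n m r : ℕ}

/-! ## The abstract mod-period selector -/

/-- The image of an `∅`-definable set of `m`-tuples under an integer linear functional is an `∅`-definable subset of `ℂ`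
(projection of the definable graph `{(s, v) | v ∈ T ∧ s = Σ ℓ_k v_k}`). [cite: KirbyMacintyreOnshuus2012, §2] -/
theorem definable₁_image_intFunctional {T : Set (Fin m → ℂ)} (hT : (∅ : Set ℂ).Definable Language.expRing T)
    (ℓ : Fin m → ℤ) :
    Set.Definable₁ (∅ : Set ℂ) Language.expRing ((fun v : Fin m → ℂ => ∑ k, (ℓ k : ℂ) * v k) '' T) := by
  have hgraph : (∅ : Set ℂ).Definable Language.expRing
      {w : Fin 1 ⊕ Fin m → ℂ | w ∘ Sum.inr ∈ T ∧ w (Sum.inl 0) = ∑ k, (ℓ k : ℂ) * w (Sum.inr k)} := by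
    refine definable_setOf_and_params (hT.preimage_comp Sum.inr) ?_
    exact definable_setOf_eq_params (definableFun_proj_params _)
      (definableFun_finsetSum _ fun k _ => definableFun_mul' (definableFun_intCast' _) (definableFun_proj_params _))
  have h := hgraph.exists_of_finite
  unfold Set.Definable₁
  convert h using 1
  ext z
  simp only [mem_setOf_eq, mem_image, Sum.elim_comp_inr, Sum.elim_inl, Sum.elim_inr]
  constructor
  · rintro ⟨v, hv, hz⟩
    exact ⟨v, hv, hz.symm⟩
  · rintro ⟨v, hv, hz⟩
    exact ⟨v, hv, hz.symm⟩

/-- **THE MOD-PERIOD SELECTOR.**  Let `V ⊆ ℂ^m` be `∅`-definable in `ℂ_exp` with `{exp ∘ v : v ∈ V}` finite and `u ∈ V`, and suppose the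
copy in `ℂ^m` of the hit pattern `H = {κ ∈ ℤ^m : u + 2πiκ ∈ V}` is `∅`-definable.  Then for every integer functional `ℓ` annihilating every
period of `H` (`H = H − μ ⇒ ℓ·μ = 0`), the value `ℓ·u = Σ ℓ_k u_k` lies in `acl^{ℂ_exp}(∅)`: on the exact-pattern set (`∅`-definable,
contains `u`, lies in `V`) two points with the same exponentials and the same kernel sign differ by `t·μ` with `μ` a period
(`pattern_translate_period`), so `ℓ·(−)` takes one value per exponential class and sign — finitely many.  No aperiodicity is assumed;
with `H` aperiodic every `ℓ` qualifies and this is `definableClassSelector`. [cite: KirbyMacintyreOnshuus2012, §2] -/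
theorem classSelector_modPeriod {V : Set (Fin m → ℂ)} (hV : (∅ : Set ℂ).Definable Language.expRing V)
    (hVfin : ((fun v : Fin m → ℂ => cexp ∘ v) '' V).Finite) {u : Fin m → ℂ} (hu : u ∈ V)
    (hHdef : (∅ : Set ℂ).Definable Language.expRing
      {w : Fin m → ℂ | ∃ κ : Fin m → ℤ, (∀ k, w k = (κ k : ℂ)) ∧ (fun k => u k + 2 * ↑Real.pi * I * (κ k : ℂ)) ∈ V})
    (ℓ : Fin m → ℤ)
    (hℓ : ∀ μ : Fin m → ℤ,
      (∀ κ : Fin m → ℤ, (fun k => u k + 2 * ↑Real.pi * I * (κ k : ℂ)) ∈ V ↔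
        (fun k => u k + 2 * ↑Real.pi * I * ((μ + κ : Fin m → ℤ) k : ℂ)) ∈ V) → ∑ k, ℓ k * μ k = 0) :
    (∑ k, (ℓ k : ℂ) * u k) ∈ expAcl := by
  classical
  -- name the definable copy `Hc` of the pattern and the abstract pattern `P`
  generalize hHc : {w : Fin m → ℂ | ∃ κ : Fin m → ℤ, (∀ k, w k = (κ k : ℂ)) ∧
      (fun k => u k + 2 * ↑Real.pi * I * (κ k : ℂ)) ∈ V} = Hc at hHdef
  obtain ⟨P, hP⟩ : ∃ P : Set (Fin m → ℤ), ∀ κ : Fin m → ℤ,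
      κ ∈ P ↔ (fun k => u k + 2 * ↑Real.pi * I * (κ k : ℂ)) ∈ V := ⟨_, fun _ => Iff.rfl⟩
  have hmemHc : ∀ κ : Fin m → ℤ, (fun k => (κ k : ℂ)) ∈ Hc ↔ κ ∈ P := by
    intro κ
    rw [hP, ← hHc]
    constructor
    · rintro ⟨κ', hκ', hV'⟩
      have : κ = κ' := funext fun k => by
        have h : ((κ k : ℤ) : ℂ) = (κ' k : ℂ) := hκ' k
        exact_mod_cast h
      subst this; exact hV'
    · intro h; exact ⟨κ, fun _ => rfl, h⟩
  have h0 : (0 : Fin m → ℤ) ∈ P := by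
    rw [hP]
    have e : (fun k => u k + 2 * ↑Real.pi * I * ((0 : Fin m → ℤ) k : ℂ)) = u := by
      funext k; simp
    rw [e]; exact hu
  -- periods of `P` are annihilated by `ℓ`
  have hℓP : ∀ μ : Fin m → ℤ, (∀ κ : Fin m → ℤ, κ ∈ P ↔ μ + κ ∈ P) → ∑ k, ℓ k * μ k = 0 := by
    intro μ hper
    refine hℓ μ fun κ => ?_
    rw [← hP, ← hP]
    exact hper κ
  -- the pattern predicate for a generator `t`: the exact integer pattern of `v` w.r.t. `t` is `Hc`
  obtain ⟨Pat, hPat⟩ : ∃ Pat : ℂ → (Fin m → ℂ) → Prop, ∀ t v, Pat t v ↔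
      ∀ w : Fin m → ℂ, (∀ k, w k ∈ intSet) → ((fun k => v k + t * w k) ∈ V ↔ w ∈ Hc) := ⟨_, fun _ _ => Iff.rfl⟩
  have hPat_iff : ∀ (t : ℂ) (v : Fin m → ℂ), Pat t v →
      ∀ κ : Fin m → ℤ, (fun k => v k + t * (κ k : ℂ)) ∈ V ↔ κ ∈ P := by
    intro t v hv κ
    rw [← hmemHc]
    exact (hPat t v).1 hv (fun k => (κ k : ℂ)) (fun k => mem_intSet_iff.2 ⟨κ k, rfl⟩)
  -- `u` has pattern `Hc` w.r.t. `t = 2πi`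
  have huPat : Pat (2 * ↑Real.pi * I) u := by
    refine (hPat _ _).2 fun w hw => ?_
    choose κ hκ using fun k => mem_intSet_iff.1 (hw k)
    have ew : w = fun k => (κ k : ℂ) := funext hκ
    subst ew
    rw [hmemHc, hP]
  -- the selector set `T` and the functional `L`
  set L : (Fin m → ℂ) → ℂ := fun v => ∑ k, (ℓ k : ℂ) * v k with hL
  have hTdef : (∅ : Set ℂ).Definable Language.expRing {v : Fin m → ℂ | ∃ t : ℂ, t ∈ kerGenSet ∧ Pat t v} := by
    have h := definable_patternSet_of_definable hV hHdef
    convert h using 2 with v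
    simp only [hPat]
  have huT : u ∈ {v : Fin m → ℂ | ∃ t : ℂ, t ∈ kerGenSet ∧ Pat t v} :=
    ⟨2 * ↑Real.pi * I, mem_kerGenSet_iff.2 (Or.inl rfl), huPat⟩
  -- on each sign, `L` is constant on the exponential classes of the pattern set, so its image is finite
  have hTt : ∀ t : ℂ, t ∈ kerGenSet → Set.Finite (L '' {v | Pat t v}) := by
    intro t ht
    have hsub : {v | Pat t v} ⊆ V := by
      intro v hv
      have h := (hPat_iff t v hv 0).2 h0
      have e : (fun k => v k + t * ((0 : Fin m → ℤ) k : ℂ)) = v := by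
        funext k; simp
      rwa [e] at h
    -- a section of `exp ∘ ·` on the pattern set
    set g : (Fin m → ℂ) → ℂ := fun e =>
      if h : ∃ v : Fin m → ℂ, Pat t v ∧ (cexp ∘ v) = e then L h.choose else 0 with hg
    refine ((hVfin.subset (Set.image_mono hsub)).image g).subset ?_
    rintro _ ⟨v, hv, rfl⟩
    refine ⟨cexp ∘ v, ⟨v, hv, rfl⟩, ?_⟩
    have hex : ∃ v' : Fin m → ℂ, Pat t v' ∧ (cexp ∘ v') = cexp ∘ v := ⟨v, hv, rfl⟩
    have hg' : g (cexp ∘ v) = L hex.choose := by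
      simp only [hg, hex, dif_pos]
    rw [hg']
    obtain ⟨hv', hexp⟩ := hex.choose_spec
    obtain ⟨μ, hμ⟩ := exists_int_translate_of_cexp_eq ht hexp
    have hper : ∀ κ : Fin m → ℤ, κ ∈ P ↔ μ + κ ∈ P := by
      refine pattern_translate_period (V := V) (t := t) μ (hPat_iff t v (hv : Pat t v)) ?_
      intro κ
      have h := hPat_iff t _ hv' κ
      rw [hμ] at h
      exact h
    have hsum : ∑ k, ℓ k * μ k = 0 := hℓP μ hper
    have hsumC : (∑ k, (ℓ k : ℂ) * (μ k : ℂ)) = 0 := by exact_mod_cast hsum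
    rw [hμ]
    simp only [hL]
    have e : (∑ k, (ℓ k : ℂ) * (v k + t * (μ k : ℂ))) = (∑ k, (ℓ k : ℂ) * v k) + t * ∑ k, (ℓ k : ℂ) * (μ k : ℂ) := by
      rw [Finset.mul_sum, ← Finset.sum_add_distrib]
      refine Finset.sum_congr rfl fun k _ => ?_
      ring
    rw [e, hsumC, mul_zero, add_zero]
  have hSfin : Set.Finite (L '' {v : Fin m → ℂ | ∃ t : ℂ, t ∈ kerGenSet ∧ Pat t v}) := by
    have hcover : L '' {v : Fin m → ℂ | ∃ t : ℂ, t ∈ kerGenSet ∧ Pat t v} ⊆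
        L '' {v | Pat (2 * ↑Real.pi * I) v} ∪ L '' {v | Pat (-(2 * ↑Real.pi * I)) v} := by
      rintro _ ⟨v, ⟨t, ht, hv⟩, rfl⟩
      rcases mem_kerGenSet_iff.1 ht with rfl | rfl
      · exact Or.inl ⟨v, hv, rfl⟩
      · exact Or.inr ⟨v, hv, rfl⟩
    exact ((hTt _ (mem_kerGenSet_iff.2 (Or.inl rfl))).union (hTt _ (mem_kerGenSet_iff.2 (Or.inr rfl)))).subset hcover
  exact ⟨L '' {v : Fin m → ℂ | ∃ t : ℂ, t ∈ kerGenSet ∧ Pat t v}, hSfin, definable₁_image_intFunctional hTdef ℓ,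
    ⟨u, huT, rfl⟩⟩

/-- Sanity: with an APERIODIC pattern every functional qualifies, and the mod-period selector returns each coordinate
(`definableClassSelector`'s conclusion for the coordinate functional `ℓ = e_k`). [cite: KirbyMacintyreOnshuus2012, §2] -/
theorem classSelector_modPeriod_coord_of_aperiodic {V : Set (Fin m → ℂ)} (hV : (∅ : Set ℂ).Definable Language.expRing V)
    (hVfin : ((fun v : Fin m → ℂ => cexp ∘ v) '' V).Finite) {u : Fin m → ℂ} (hu : u ∈ V)
    (hHdef : (∅ : Set ℂ).Definable Language.expRing
      {w : Fin m → ℂ | ∃ κ : Fin m → ℤ, (∀ k, w k = (κ k : ℂ)) ∧ (fun k => u k + 2 * ↑Real.pi * I * (κ k : ℂ)) ∈ V})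
    (haper : ∀ μ : Fin m → ℤ,
      (∀ κ : Fin m → ℤ, (fun k => u k + 2 * ↑Real.pi * I * (κ k : ℂ)) ∈ V ↔
        (fun k => u k + 2 * ↑Real.pi * I * ((μ + κ : Fin m → ℤ) k : ℂ)) ∈ V) → μ = 0) (k : Fin m) :
    u k ∈ expAcl := by
  classical
  have h := classSelector_modPeriod hV hVfin hu hHdef (fun j => if j = k then 1 else 0) fun μ hμ => by
    rw [haper μ hμ]; simp
  simpa [Finset.sum_ite_eq', Finset.mem_univ] using h

/-! ## The log part of a first failure: cast-free coordinate form -/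

/-- **INTEGER COMBINATIONS OF THE LOG COORDINATES ANNIHILATING THE PERIOD LATTICE ARE IN `acl(∅)`** (every rank, any `r ≤ n`; no
aperiodicity).  For ℚ-linearly independent `x` with `e^{x_i}` algebraic for `i < r` and `∅`-definable (cast-free) hit pattern of the log
part: if `ℓ ∈ ℤⁿ` is supported on the log indices and `Σ_i ℓ_i μ_i = 0` for every period `μ` of the pattern supported on the log indices,
then `Σ_i ℓ_i x_i ∈ acl^{ℂ_exp}(∅)` (`classSelector_modPeriod` in the coordinate frame of Theorems/…CorankGeTwoLogPart).
[cite: KirbyMacintyreOnshuus2012, §2] -/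
theorem logCombos_mem_expAcl_of_pattern_modPeriod (hr : r ≤ n) {x : Fin n → ℂ} (hx : LinearIndependent ℚ x)
    (halg : ∀ i : Fin n, (i : ℕ) < r → IsAlgebraic ℚ (cexp (x i)))
    (hP : (∅ : Set ℂ).Definable Language.expRing
      {w : Fin n → ℂ | ∃ κ : Fin n → ℤ, (∀ i, w i = (κ i : ℂ)) ∧ (∀ i : Fin n, r ≤ (i : ℕ) → κ i = 0) ∧
        ∃ x' ∈ locusMates x, ∀ i : Fin n, (i : ℕ) < r → x' i = x i + 2 * ↑Real.pi * I * (κ i : ℂ)})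
    (ℓ : Fin n → ℤ) (hℓsupp : ∀ i : Fin n, r ≤ (i : ℕ) → ℓ i = 0)
    (hℓ : ∀ μ : Fin n → ℤ, (∀ i : Fin n, r ≤ (i : ℕ) → μ i = 0) →
      (∀ κ : Fin n → ℤ, (∀ i : Fin n, r ≤ (i : ℕ) → κ i = 0) →
        ((∃ x' ∈ locusMates x, ∀ i : Fin n, (i : ℕ) < r → x' i = x i + 2 * ↑Real.pi * I * (κ i : ℂ)) ↔
          ∃ x' ∈ locusMates x, ∀ i : Fin n, (i : ℕ) < r → x' i = x i + 2 * ↑Real.pi * I * ((μ + κ) i : ℂ))) →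
      ∑ i, ℓ i * μ i = 0) :
    (∑ i, (ℓ i : ℂ) * x i) ∈ expAcl := by
  classical
  set M : Fin r → Fin n → ℤ := fun k i => if (i : ℕ) = (k : ℕ) then 1 else 0 with hM
  have hsum : ∀ (y : Fin n → ℂ) (k : Fin r), (∑ i, (M k i : ℂ) * y i) = y (Fin.castLE hr k) :=
    fun y k => coordFrameLT_sum hr y k
  have hVdef : (∅ : Set ℂ).Definable Language.expRing {v : Fin r → ℂ | ∃ x' ∈ locusMates x, ∀ k, v k = x' (Fin.castLE hr k)} := by
    rw [← valueTuples_coordFrameLT hr x]; exact valueTuples_definable x M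
  have hVfin : ((fun v : Fin r → ℂ => cexp ∘ v) '' {v : Fin r → ℂ | ∃ x' ∈ locusMates x, ∀ k, v k = x' (Fin.castLE hr k)}).Finite := by
    have halg' : ∀ k, IsAlgebraic ℚ (cexp (∑ i, (M k i : ℂ) * x i)) := fun k => by
      rw [hsum]; exact halg _ (by simp)
    rw [← valueTuples_coordFrameLT hr x]; exact cexp_image_valueTuples_finite x M halg'
  have huV : (fun k => x (Fin.castLE hr k)) ∈ {v : Fin r → ℂ | ∃ x' ∈ locusMates x, ∀ k, v k = x' (Fin.castLE hr k)} :=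
    ⟨x, self_mem_locusMates x hx, fun _ => rfl⟩
  -- the frame functional and the frame form of `hℓ`
  set ℓ' : Fin r → ℤ := fun k => ℓ (Fin.castLE hr k) with hℓ'
  set ext0 : (Fin r → ℤ) → Fin n → ℤ := fun κ i => if h : (i : ℕ) < r then κ ⟨i, h⟩ else 0 with hext0
  have hsupp : ∀ κ : Fin r → ℤ, ∀ i : Fin n, r ≤ (i : ℕ) → ext0 κ i = 0 := fun κ i hi => by
    have : ¬ (i : ℕ) < r := not_lt.2 hi
    simp [hext0, this]
  have hcast : ∀ (κ : Fin r → ℤ) (k : Fin r), ext0 κ (Fin.castLE hr k) = κ k := fun κ k => extendByZero_apply_castLE hr κ k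
  have hiff : ∀ κ : Fin r → ℤ,
      ((fun k => x (Fin.castLE hr k) + 2 * ↑Real.pi * I * (κ k : ℂ)) ∈
          {v : Fin r → ℂ | ∃ x' ∈ locusMates x, ∀ k, v k = x' (Fin.castLE hr k)}) ↔
        ∃ x' ∈ locusMates x, ∀ i : Fin n, (i : ℕ) < r → x' i = x i + 2 * ↑Real.pi * I * (ext0 κ i : ℂ) := by
    intro κ
    refine ⟨fun ⟨x', hx', hv⟩ => ⟨x', hx', fun i hi => ?_⟩, fun ⟨x', hx', hv⟩ => ⟨x', hx', fun k => ?_⟩⟩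
    · have e : ext0 κ i = κ ⟨i, hi⟩ := by simp [hext0, hi]
      rw [e]; simpa using (hv ⟨i, hi⟩).symm
    · have h := hv (Fin.castLE hr k) (by simp)
      rw [hcast] at h; exact h.symm
  -- sums over `Fin n` supported on the log indices are sums over the frame
  have hsumFrame : ∀ {β : Type} [AddCommMonoid β] (f : Fin n → β), (∀ i : Fin n, r ≤ (i : ℕ) → f i = 0) →
      (∑ i, f i) = ∑ k : Fin r, f (Fin.castLE hr k) := by
    intro β _ f hf
    have hinj : Function.Injective (Fin.castLE hr : Fin r → Fin n) := Fin.castLE_injective hr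
    rw [← Finset.sum_image (f := f) (s := Finset.univ) (g := Fin.castLE hr) fun a _ b _ h => hinj h]
    symm
    refine Finset.sum_subset (Finset.subset_univ _) fun i _ hi => hf i ?_
    by_contra hlt
    exact hi (Finset.mem_image.2 ⟨⟨i, not_le.1 hlt⟩, Finset.mem_univ _, by ext; simp⟩)
  have hℓ'per : ∀ μ : Fin r → ℤ,
      (∀ κ : Fin r → ℤ, (fun k => x (Fin.castLE hr k) + 2 * ↑Real.pi * I * (κ k : ℂ)) ∈
          {v : Fin r → ℂ | ∃ x' ∈ locusMates x, ∀ k, v k = x' (Fin.castLE hr k)} ↔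
        (fun k => x (Fin.castLE hr k) + 2 * ↑Real.pi * I * ((μ + κ : Fin r → ℤ) k : ℂ)) ∈
          {v : Fin r → ℂ | ∃ x' ∈ locusMates x, ∀ k, v k = x' (Fin.castLE hr k)}) → ∑ k, ℓ' k * μ k = 0 := by
    intro μ hper
    have hμ := hℓ (ext0 μ) (hsupp μ) fun κ hκ => by
      have eκ : ext0 (fun k => κ (Fin.castLE hr k)) = κ := by
        funext i
        by_cases hi : (i : ℕ) < r
        · simp only [hext0, hi, dif_pos]; congr 1
        · simp only [hext0, hi, dif_neg, not_false_eq_true]; exact (hκ i (not_lt.1 hi)).symm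
      have eμκ : ext0 (μ + fun k => κ (Fin.castLE hr k)) = ext0 μ + κ := by
        funext i
        by_cases hi : (i : ℕ) < r
        · have := congr_fun eκ i
          simp only [hext0, hi, dif_pos] at this
          simp only [hext0, hi, dif_pos, Pi.add_apply]; rw [this]
        · simp only [hext0, hi, dif_neg, not_false_eq_true, Pi.add_apply, zero_add]; exact (hκ i (not_lt.1 hi)).symm
      have h1 := hiff (fun k => κ (Fin.castLE hr k))
      have h2 := hiff (μ + fun k => κ (Fin.castLE hr k))
      rw [eκ] at h1; rw [eμκ] at h2
      rw [← h1, ← h2]; exact hper _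
    -- `Σ_i ℓ_i (ext0 μ)_i = Σ_k ℓ'_k μ_k`
    have e : (∑ i, ℓ i * ext0 μ i) = ∑ k : Fin r, ℓ' k * μ k := by
      rw [hsumFrame (fun i => ℓ i * ext0 μ i) fun i hi => by rw [hsupp μ i hi]; simp]
      refine Finset.sum_congr rfl fun k _ => ?_
      rw [hcast]
    rw [← e]; exact hμ
  have key := classSelector_modPeriod hVdef hVfin huV (framePattern_definable_of_pattern hr hP) ℓ' hℓ'per
  -- `Σ_i ℓ_i x_i = Σ_k ℓ'_k x_{castLE k}`
  have e : (∑ i, (ℓ i : ℂ) * x i) = ∑ k : Fin r, (ℓ' k : ℂ) * x (Fin.castLE hr k) :=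
    hsumFrame (fun i => (ℓ i : ℂ) * x i) fun i hi => by rw [hℓsupp i hi]; simp
  rw [e]; exact key

/-! ## Registered form: the unconditional corank ≥ 2 theorem
(`ledger workitem stub-add stmt-Schanuel-0969 --name stub_corankGeTwo_logCombosModPeriod …`) -/

/-- **UNCONDITIONAL: THE LOG PART OF A CORANK ≥ 2 FIRST FAILURE IS `∅`-ALGEBRAIC MODULO THE PERIOD LATTICE OF ITS HIT PATTERN**
(registered stub `stub_corankGeTwo_logCombosModPeriod` of crux stmt-Schanuel-0969, line kernel-arithmetic-selection, lead c14).  For a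
normal-form first failure `x` of rank `n ≥ 3` with `r ≤ n − 2` log coordinates (`e^{x_i} ∈ ℚ̄` for `i < r`, pure in the remaining
directions) and every `ℓ ∈ ℤⁿ` supported on the log indices that annihilates every period (supported on the log indices) of the hit
pattern of the log part, `Σ_i ℓ_i x_i ∈ acl^{ℂ_exp}(∅)` — S7a (`stub_corankGeTwo_hitSetRingDefinable`: the pattern is ring-definable over `ℤ`)
+ transfer (`stub_arithmeticTransfer`) + the mod-period selector.  A period `μ ≠ 0` means that EVERY hit line in direction `μ` is a full
line of mates; with no period this is `stub_corankGeTwo_logCoordsAperiodic`. [cite: Kirby2010, Prop. 7.2] -/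
theorem stub_corankGeTwo_logCombosModPeriod : ∀ (n r : ℕ), 3 ≤ n → r + 2 ≤ n → ∀ (x : Fin n → ℂ), x ∈ Summit.Schanuel.Schanuel.Cruxes.MinimalCounterexampleInAcl.KernelArithmeticSelection.firstFailures n → (∀ i : Fin n, (i : ℕ) < r → IsAlgebraic ℚ (Complex.exp (x i))) → (∀ M : Fin n → ℤ, (∃ i : Fin n, r ≤ (i : ℕ) ∧ M i ≠ 0) → Transcendental ℚ (Complex.exp (∑ i, (M i : ℂ) * x i))) → ∀ ℓ : Fin n → ℤ, (∀ i : Fin n, r ≤ (i : ℕ) → ℓ i = 0) → (∀ μ : Fin n → ℤ, (∀ i : Fin n, r ≤ (i : ℕ) → μ i = 0) → (∀ κ : Fin n → ℤ, (∀ i : Fin n, r ≤ (i : ℕ) → κ i = 0) → ((∃ x' ∈ Summit.Schanuel.Schanuel.Cruxes.MinimalCounterexampleInAcl.KernelArithmeticSelection.locusMates x, ∀ i : Fin n, (i : ℕ) < r → x' i = x i + 2 * ↑Real.pi * Complex.I * (κ i : ℂ)) ↔ ∃ x' ∈ Summit.Schanuel.Schanuel.Cruxes.MinimalCounterexampleInAcl.KernelArithmeticSelection.locusMates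 x, ∀ i : Fin n, (i : ℕ) < r → x' i = x i + 2 * ↑Real.pi * Complex.I * ((μ + κ) i : ℂ))) → ∑ i, ℓ i * μ i = 0) → (∑ i, (ℓ i : ℂ) * x i) ∈ Summit.Schanuel.Schanuel.Theorems.AclSubsetLogFreeCore.Negative.expAcl := by
  intro n r hn hr x hx halg hpure ℓ hℓsupp hℓ
  have hA := @stub_corankGeTwo_hitSetRingDefinable n r hn hr x hx halg hpure (FirstOrder.Ring.compatibleRingOfRing ℤ)
  have hT := stub_arithmeticTransfer n _ hA
  refine logCombos_mem_expAcl_of_pattern_modPeriod (by omega) hx.1 halg ?_ ℓ hℓsupp hℓ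
  convert hT using 1
  ext w
  simp only [mem_setOf_eq]
  constructor
  · rintro ⟨κ, hw, hκ0, hx'⟩
    exact ⟨κ, ⟨hκ0, hx'⟩, hw⟩
  · rintro ⟨κ, ⟨hκ0, hx'⟩, hw⟩
    exact ⟨κ, hw, hκ0, hx'⟩

end Summit.Schanuel.Schanuel.Cruxes.MinimalCounterexampleInAcl.KernelArithmeticSelection

end
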